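import Mathlib
import HarnessLib
import Summits.HubbardSuperconductivity.HubbardSuperconductivity.Theorems.KLProgrammePerturbedFermiCurveCooperPackage
import Summits.HubbardSuperconductivity.HubbardSuperconductivity.Theorems.KLProgrammePerturbedFermiCurveCausticPackage

/-!
# Route `KLProgramme` — ENGINE child (stmt-HubbardSuperconductivity-20437 `KLRegimeEngineV17F2`): Lemmas E.1/E.3 on the FRAME curve, ANGULAR FORM, EVERY TRANSFER
# (step (T3c-0); design note HOME/hubbard-kl-k3c2-p2/TWO-SHELL-FRAME-PORT.md §9)

Cell `gate-hubbard-kl`, seat hubbard-kl-k3c2-p2 g15.  Frame twin of p1b's `kltb_exists_angular_bound` (iii): constants `δ₀, C₁, C₂ > 0` depending only on the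
`BandBounds` bundle, `κ₁ < Dt_min` and `GeomConstants (frameLevel μ K) Kc r₀ g₀ w` (NOT on the degree of `K`) such that for every admissible level `ν` (margin `η⋆`,
`|ν − μ| ≤ r₀/2`), every `0 < δ ≤ δ₀`, every transfer `w⃗` and every lower bound `0 < r` of the torus sup-distance of `w⃗` to `2πℤ²`:
`|{θ ∈ [θ₀, θ₀ + 2π] : |E(p_ν(θ) − w⃗) − ν| ≤ δ}| ≤ C₁δ/r + C₂√δ` (**`exists_angular_bound_frame`**).  Dichotomy: the reduced transfer `w⃗ + 2πm` is in the
Cooper ball (`exists_cooper_bound_frame`, the sublevel set is `2πℤ²`-periodic in `w⃗`) or `w⃗` keeps torus distance `≥ v_C` (`exists_away_bound_frame`, `r ≤ π`).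
Everything is PROVED; no definitions, no named facts; nothing asserts any stub or superconductivity.
References: DECOMP App. E Lemmas E.1/E.3; FST II App. B [cite: FeldmanSalmhoferTrubowitz1998]; BGM 2006 §2.7 [cite: BenfattoGiulianiMastropietro2006].
-/

noncomputable section

namespace Summit.HubbardSuperconductivity.HubbardSuperconductivity.Theorems.PerturbedFermiCurve

set_option linter.dupNamespace false -- summit = problem name (single-conjunct summit), D-0017

open Real Set MeasureTheory
open scoped ENNReal
open Literature.MathematicalPhysics.QuantumLattice Literature.MathematicalPhysics.QuantumLattice.BandSectorCounting
open Literature.MathematicalPhysics.QuantumLattice.FermiRG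
open Summit.HubbardSuperconductivity.HubbardSuperconductivity.Theorems.DispersionFlow
open Summit.HubbardSuperconductivity.HubbardSuperconductivity.Theorems.KLRegimeSplit

/-- **The translated level is `2πℤ²`-periodic in the transfer**: `E(q − (w⃗ + 2πm)) = E(q − w⃗)`. [folklore] -/
theorem transLevel_transfer_add_int_mul_eq (K : TrigPolyC4v) (q wv : Fin 2 → ℝ) (m : Fin 2 → ℤ) :
    sqDispersion (q - fun i => wv i + m i * (2 * π)) + -K.eval (q - fun i => wv i + m i * (2 * π)) =
      sqDispersion (q - wv) + -K.eval (q - wv) := by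
  have h := transLevel_sub_int_mul_eq K (q - wv) m
  have e : (fun i => (q - wv) i - m i * (2 * π)) = q - fun i => wv i + m i * (2 * π) := by
    funext i; simp only [Pi.sub_apply]; ring
  rw [e] at h
  exact h

section Frame

variable {a b : ℝ} (B : BandBounds a b) {K : TrigPolyC4v} {κ₀ κ₁ : ℝ}
  (hδ : ∀ k : Fin 2 → ℝ, (∀ i, |k i| ≤ π) → |(fun k : Fin 2 → ℝ => -K.eval k) k| ≤ κ₀)
  (hκ : ∀ k : Fin 2 → ℝ, (∀ i, |k i| ≤ π) → ‖fderiv ℝ (fun k : Fin 2 → ℝ => -K.eval k) k‖ ≤ κ₁) (hκ₁ : κ₁ < B.Dtmin)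
  {μ Kc r₀ g₀ w : ℝ} (hG : GeomConstants (frameLevel μ K) Kc r₀ g₀ w)
include B hδ hκ hκ₁ hG

/-- **Lemmas E.1/E.3 on the frame curve, angular form, every transfer** (see the module docstring). [cite: FeldmanSalmhoferTrubowitz1998, App. B] -/
theorem exists_angular_bound_frame {ηs : ℝ} (hηs : 0 < ηs) :
    ∃ δ₀ C₁ C₂ : ℝ, 0 < δ₀ ∧ 0 < C₁ ∧ 0 < C₂ ∧
      ∀ ν : ℝ, a + ηs ≤ ν - κ₀ → ν + κ₀ ≤ b - ηs → |ν - μ| ≤ r₀ / 2 →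
        ∀ (δ : ℝ) (wv : Fin 2 → ℝ) (θ₀ r : ℝ), 0 < δ → δ ≤ δ₀ → 0 < r → (∀ m : Fin 2 → ℤ, ∃ i, r ≤ |wv i + m i * (2 * π)|) →
          volume {θ ∈ Icc θ₀ (θ₀ + 2 * π) |
              |sqDispersion (perturbedFermiRadius (fun k : Fin 2 → ℝ => -K.eval k) ν θ • dir θ - wv) +
                  -K.eval (perturbedFermiRadius (fun k : Fin 2 → ℝ => -K.eval k) ν θ • dir θ - wv) - ν| ≤ δ} ≤
            ENNReal.ofReal (C₁ * δ / r + C₂ * Real.sqrt δ) := by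
  have hπ := Real.pi_pos
  have hr₀ := hG.r₀_pos
  obtain ⟨vC, δ₁, C, hvC, hδ₁, hC, hcooper⟩ := exists_cooper_bound_frame B hδ hκ hκ₁ hG hηs
  obtain ⟨δ₁', C₁', C₂', hδ₁', hC₁', hC₂', haway⟩ := exists_away_bound_frame B hδ hκ hκ₁ hG hηs hvC
  refine ⟨min δ₁ δ₁', C + C₁' * π, C₂', lt_min hδ₁ hδ₁', by positivity, hC₂', ?_⟩
  intro ν hνlo hνhi hνμ δ wv θ₀ r hδ0 hδle hr htor
  have hνlt : |ν - μ| < r₀ := by linarith only [hνμ, hr₀]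
  have hδ1 : δ ≤ δ₁ := hδle.trans (min_le_left _ _)
  have hδ1' : δ ≤ δ₁' := hδle.trans (min_le_right _ _)
  set u := perturbedFermiRadius (fun k : Fin 2 → ℝ => -K.eval k) ν with hudef
  -- `r ≤ π`: the reduced transfer
  obtain ⟨m₀, hm₀⟩ : ∃ m : Fin 2 → ℤ, ∀ i, |wv i + m i * (2 * π)| ≤ π := by
    choose m hm using fun i => exists_int_abs_sub_le_pi (wv i)
    refine ⟨fun i => -m i, fun i => ?_⟩
    have := hm i
    rwa [show wv i + ((-m i : ℤ) : ℝ) * (2 * π) = wv i - m i * (2 * π) by push_cast; ring]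
  have hrπ : r ≤ π := by obtain ⟨i, hi⟩ := htor m₀; exact hi.trans (hm₀ i)
  by_cases hfar : ∀ m : Fin 2 → ℤ, ∃ i, vC ≤ |wv i + m i * (2 * π)|
  · -- torus distance `≥ v_C`: the away bound
    have h := haway ν hνlo hνhi hνμ δ wv θ₀ hδ0 hδ1' hfar
    refine h.trans (ENNReal.ofReal_le_ofReal ?_)
    have h1 : C₁' * δ ≤ C₁' * π * δ / r := by
      rw [le_div_iff₀ hr]
      have := mul_le_mul_of_nonneg_left hrπ (by positivity : 0 ≤ C₁' * δ)
      linarith only [this]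
    have h2 : 0 ≤ C * δ / r := by positivity
    have e : (C + C₁' * π) * δ / r = C * δ / r + C₁' * π * δ / r := by ring
    rw [e]; linarith only [h1, h2]
  · -- a reduced transfer in the Cooper ball
    push Not at hfar
    obtain ⟨m, hm⟩ := hfar
    set w' : Fin 2 → ℝ := fun i => wv i + m i * (2 * π) with hw'
    have hM0 : 0 < max |w' 0| |w' 1| := by
      obtain ⟨i, hi⟩ := htor m
      have : r ≤ max |w' 0| |w' 1| := by
        fin_cases i
        · exact hi.trans (le_max_left _ _)
        · exact hi.trans (le_max_right _ _)
      exact hr.trans_le this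
    have hrM : r ≤ max |w' 0| |w' 1| := by
      obtain ⟨i, hi⟩ := htor m
      fin_cases i
      · exact hi.trans (le_max_left _ _)
      · exact hi.trans (le_max_right _ _)
    have hMv : max |w' 0| |w' 1| ≤ vC := max_le (hm 0).le (hm 1).le
    have h := hcooper ν hνlo hνhi hνlt δ w' θ₀ hδ0 hδ1 hM0 hMv
    -- the sublevel sets for `w'` and `wv` coincide
    have hset : {θ ∈ Icc θ₀ (θ₀ + 2 * π) | |sqDispersion (u θ • dir θ - w') + -K.eval (u θ • dir θ - w') - ν| ≤ δ} =
        {θ ∈ Icc θ₀ (θ₀ + 2 * π) | |sqDispersion (u θ • dir θ - wv) + -K.eval (u θ • dir θ - wv) - ν| ≤ δ} := by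
      ext θ
      simp only [mem_setOf_eq, hw', transLevel_transfer_add_int_mul_eq]
    rw [hset] at h
    refine h.trans (ENNReal.ofReal_le_ofReal ?_)
    have h1 : C * δ / max |w' 0| |w' 1| ≤ C * δ / r := div_le_div_of_nonneg_left (by positivity) hr hrM
    have h2 : 0 ≤ C₁' * π * δ / r := by positivity
    have h3 : 0 ≤ C₂' * Real.sqrt δ := by positivity
    have e : (C + C₁' * π) * δ / r = C * δ / r + C₁' * π * δ / r := by ring
    rw [e]; linarith only [h1, h2, h3]

end Frame

end Summit.HubbardSuperconductivity.HubbardSuperconductivity.Theorems.PerturbedFermiCurve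

end
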